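import Summits.CriticalPhenomena.PercolationContinuityZ3.Theorems.PercNearOneGluingNoHeavyPcintBSMTail
import Summits.CriticalPhenomena.PercolationContinuityZ3.Theorems.PercNearOneGluingNoHeavyPcintBSMMoments
import Summits.CriticalPhenomena.PercolationContinuityZ3.Theorems.PercNearOneGluingNoHeavyPcintBSMLocal
import Summits.CriticalPhenomena.PercolationContinuityZ3.Theorems.PercNearOneGluingNoHeavyPcintOSMAssembly
import HarnessLib

/-!
# PCINT lane, PHASE 5 (block-renewal second moment), step 8: the certificate theorem

Cell `prim-pcint`, seat `prim-pcint-1` (gen 14); memo `run/shared/lean/prim/pcint/T-FIBRE-ROUTE.md` §PHASE 5.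

**`BSM.criticalProb_le_of_cert`.**  Let `t ≥ 3` transverse and `k ≥ 2` time axes, a piece table `pc` with endpoints
and key vertices in the cube, weights `w ≥ 0` with product endpoint marginal `Π_i g₃ s (v i)` (`0 < s ≤ 1`),
`0 < p ≤ 1`, `x = 1/p`, a truncation `N ≥ 1`, a constant `c > 0` and a nonnegative function `φ` on transverse offsets.
If for every `y` in the box `[-2,2]^t`

  `Σ_{σ,σ'} w σ w σ' [ (1/k) (x^{S + e} - 1) V₀(u) + ((k-1)/k) (x^S - 1) V₁(u) ] ≤ φ y`

(`S` = shared transverse edge keys of the pieces at offset `y`, `e = 𝟙[pend σ = pend σ' + y]`,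
`u = y + pend σ' - pend σ`, tables `V̂_j ≥ V_j` on `[-4,4]^t` where `V_j(u) = c + Σ_{z ∈ box} (GjN N (z-u) + C k s/N) φ z`
with the finite Green sums of …BSMTail), then `p_c^bond(ℤ^{k+t}) ≤ p`.  Proof: the local count at time offset `0` splits as `S + 𝟙[a = a'] e`
(`BSM.Rloc_zero`, …BSMLocal); summing the certificate condition of `BSM.A_le_of_cert'` over the time axes `a, a'` gives the
diagonal class (`BSM.Gm_zero_eq`) and the adjacent classes (`BSM.sum_Gm_adj_eq`), with any tail bound `T`
(`BSM.TailBound`: `BSM.tailBound_ctail` or `BSM.tailBound_osm`);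
then `A x n 0 ≤ V₀(0)/c`, `P_p(0 ⟷ ∂B(0,m)) ≥ c/V₀(0) > 0` (`BSM.le_real_armEvent`), `θ(p) > 0`, `p_c ≤ p`.
-/

noncomputable section

namespace Summit.CriticalPhenomena.PercolationContinuityZ3.Theorems.Pcint.BSM

open Finset OSM Literature.Probability.Percolation Literature.Probability.LatticeModels

variable {t k np : ℕ}

/-! ### The certificate functional -/

/-- `V₀(u) = c + Σ_{z ∈ box} (G0N N (z - u) + T) φ z` for a tail bound `T`. -/
def V0 (k : ℕ) (s : ℝ) (N : ℕ) (T c : ℝ) (φ : (Fin t → ℤ) → ℝ) (u : Fin t → ℤ) : ℝ :=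
  c + ∑ z ∈ Ybox t, (G0N k s N (z - u) + T) * φ z

/-- `V₁(u) = c + Σ_{z ∈ box} (G1N N (z - u) + T) φ z`. -/
def V1 (k : ℕ) (s : ℝ) (N : ℕ) (T c : ℝ) (φ : (Fin t → ℤ) → ℝ) (u : Fin t → ℤ) : ℝ :=
  c + ∑ z ∈ Ybox t, (G1N k s N (z - u) + T) * φ z

/-- **The certificate functional** at the transverse offset `y`, with tables `V̂₀, V̂₁` dominating `V₀, V₁`. -/
def certLHS (pc : Fin np → List (Fin t × Bool)) (w : Fin np → ℝ) (k : ℕ) (x : ℝ) (V0f V1f : (Fin t → ℤ) → ℝ)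
    (y : Fin t → ℤ) : ℝ :=
  ∑ σ : Fin np, ∑ σ' : Fin np, w σ * w σ' *
    ((1 / (k : ℝ)) * (x ^ (S pc k y σ σ' + (if pend (pc σ) = pend (pc σ') + y then 1 else 0)) - 1) *
        V0f (y + (pend (pc σ') - pend (pc σ))) +
      ((k : ℝ) - 1) / k * (x ^ S pc k y σ σ' - 1) * V1f (y + (pend (pc σ') - pend (pc σ))))

/-! ### Summing the certificate term over the time axes -/

/-- The offset after a pair of blocks started at time offset `0`, transverse offset `y`. -/
theorem offset_pair (pc : Fin np → List (Fin t × Bool)) (y : Fin t → ℤ) (σ σ' : Fin np) (a a' : Fin k) :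
    (((0 : Fin k → ℤ), y) : Off t k) + δ pc (σ, a) (σ', a') = (e a' - e a, y + (pend (pc σ') - pend (pc σ))) := by
  unfold δ
  exact Prod.ext (by simp) rfl

/-- **The pair estimate.** -/
theorem pair_sum_le (hk : 2 ≤ k) {pc : Fin np → List (Fin t × Bool)} {w : Fin np → ℝ} {s : ℝ}
    (hc : Cube pc) (hm : Marg pc w s) (hw : ∀ σ, 0 ≤ w σ) {x : ℝ} (hx : 1 ≤ x)
    {N : ℕ} {T : ℝ} (hT : TailBound t k s N T) (c : ℝ) (φ : (Fin t → ℤ) → ℝ) (hφ : ∀ y, 0 ≤ φ y)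
    {V0f V1f : (Fin t → ℤ) → ℝ}
    (hV0 : ∀ u ∈ Box t 4, V0 k s N T c φ u ≤ V0f u) (hV1 : ∀ u ∈ Box t 4, V1 k s N T c φ u ≤ V1f u) (m : ℕ)
    {y : Fin t → ℤ} (hy : y ∈ Ybox t) (σ σ' : Fin np) :
    ∑ a : Fin k, ∑ a' : Fin k, νw k w (σ, a) * νw k w (σ', a') *
        (x ^ Rloc pc ((0 : Fin k → ℤ), y) (σ, a) (σ', a') - 1) *
          (c + ∑ z ∈ Ybox t, Gm pc (νw k w) m ((((0 : Fin k → ℤ), y) : Off t k) + δ pc (σ, a) (σ', a')) (0, z) * φ z) ≤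
      w σ * w σ' * ((1 / (k : ℝ)) * (x ^ (S pc k y σ σ' + (if pend (pc σ) = pend (pc σ') + y then 1 else 0)) - 1) *
          V0f (y + (pend (pc σ') - pend (pc σ))) +
        ((k : ℝ) - 1) / k * (x ^ S pc k y σ σ' - 1) * V1f (y + (pend (pc σ') - pend (pc σ)))) := by
  have hk0 : 0 < k := by omega
  have hu4 : y + (pend (pc σ') - pend (pc σ)) ∈ Box t 4 := mem_Box4 hc hy σ σ'

  have hkR : (0 : ℝ) < k := by exact_mod_cast hk0
  set uo : Fin t → ℤ := y + (pend (pc σ') - pend (pc σ)) with huo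
  set Sv : ℕ := S pc k y σ σ' with hSv
  set ev : ℕ := (if pend (pc σ) = pend (pc σ') + y then 1 else 0) with hev
  set K : ℝ := w σ * w σ' / (k : ℝ) ^ 2 with hK
  have hK0 : 0 ≤ K := by rw [hK]; exact div_nonneg (mul_nonneg (hw σ) (hw σ')) (by positivity)
  have hxS : 0 ≤ x ^ Sv - 1 := sub_nonneg.2 (one_le_pow₀ hx)
  have hxSe : 0 ≤ x ^ (Sv + ev) - 1 := sub_nonneg.2 (one_le_pow₀ hx)
  -- the Green sums appearing
  set Gz : Fin k → Fin k → (Fin t → ℤ) → ℝ := fun a a' z => Gm pc (νw k w) m (e a' - e a, uo) (0, z) with hGz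
  -- the diagonal value and the off-diagonal terms
  set Dval : ℝ := K * (x ^ (Sv + ev) - 1) * (c + ∑ z ∈ Ybox t, Gm pc (νw k w) m (0, uo) (0, z) * φ z) with hD
  set Oterm : Fin k → Fin k → ℝ := fun a a' => K * (x ^ Sv - 1) * (c + ∑ z ∈ Ybox t, Gz a a' z * φ z) with hO
  have hterm : ∀ a a' : Fin k, νw k w (σ, a) * νw k w (σ', a') *
      (x ^ Rloc pc ((0 : Fin k → ℤ), y) (σ, a) (σ', a') - 1) *
        (c + ∑ z ∈ Ybox t, Gm pc (νw k w) m ((((0 : Fin k → ℤ), y) : Off t k) + δ pc (σ, a) (σ', a')) (0, z) * φ z) =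
      if a = a' then Dval else Oterm a a' := by
    intro a a'
    rw [Rloc_zero, offset_pair]
    have hνν : νw k w (σ, a) * νw k w (σ', a') = K := by simp only [νw, hK]; ring
    rw [hνν]
    by_cases haa : a = a'
    · subst haa
      rw [if_pos rfl, hD, sub_self]
      simp only [true_and]
      rfl
    · rw [if_neg haa, hO]
      simp only [haa, false_and, if_false, add_zero, hGz]
      rfl
  simp_rw [hterm]
  -- split the double sum
  have hsplit : ∑ a : Fin k, ∑ a' : Fin k, (if a = a' then Dval else Oterm a a') =
      (k : ℝ) * Dval + ∑ a : Fin k, ∑ a' : Fin k, (if a = a' then 0 else Oterm a a') := by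
    have : ∀ a a' : Fin k, (if a = a' then Dval else Oterm a a') =
        (if a = a' then Dval else 0) + (if a = a' then 0 else Oterm a a') := by
      intro a a'; split_ifs <;> simp
    simp_rw [this, sum_add_distrib, sum_ite_eq, if_pos (mem_univ _), sum_const, card_univ, Fintype.card_fin,
      nsmul_eq_mul]
  rw [hsplit]
  -- the diagonal part
  have hdiag : (k : ℝ) * Dval ≤ w σ * w σ' * ((1 / (k : ℝ)) * (x ^ (Sv + ev) - 1) * V0f uo) := by
    have hG : c + ∑ z ∈ Ybox t, Gm pc (νw k w) m (0, uo) (0, z) * φ z ≤ V0f uo := by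
      refine le_trans ?_ (hV0 uo hu4)
      unfold V0
      refine add_le_add le_rfl (sum_le_sum fun z _ => mul_le_mul_of_nonneg_right ?_ (hφ z))
      rw [Gm_zero_eq hc hm hk0]
      exact (hT.2 m (z - uo)).1
    calc (k : ℝ) * Dval = (k : ℝ) * (K * (x ^ (Sv + ev) - 1)) *
          (c + ∑ z ∈ Ybox t, Gm pc (νw k w) m (0, uo) (0, z) * φ z) := by rw [hD]; ring
      _ ≤ (k : ℝ) * (K * (x ^ (Sv + ev) - 1)) * V0f uo :=
          mul_le_mul_of_nonneg_left hG (mul_nonneg hkR.le (mul_nonneg hK0 hxSe))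
      _ = w σ * w σ' * ((1 / (k : ℝ)) * (x ^ (Sv + ev) - 1) * V0f uo) := by
          rw [hK]; field_simp
  -- the off-diagonal part
  have hoff : ∑ a : Fin k, ∑ a' : Fin k, (if a = a' then 0 else Oterm a a') ≤
      w σ * w σ' * (((k : ℝ) - 1) / k * (x ^ Sv - 1) * V1f uo) := by
    -- pull out the constant factor
    have e1 : ∑ a : Fin k, ∑ a' : Fin k, (if a = a' then 0 else Oterm a a') =
        K * (x ^ Sv - 1) * ∑ a : Fin k, ∑ a' : Fin k, (if a = a' then 0 else (c + ∑ z ∈ Ybox t, Gz a a' z * φ z)) := by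
      rw [mul_sum]; refine sum_congr rfl fun a _ => ?_
      rw [mul_sum]; refine sum_congr rfl fun a' _ => ?_
      rw [hO]; split_ifs <;> simp
    -- the inner double sum
    have e2 : ∑ a : Fin k, ∑ a' : Fin k, (if a = a' then 0 else (c + ∑ z ∈ Ybox t, Gz a a' z * φ z)) =
        ((k : ℝ) ^ 2 - k) * c + ∑ z ∈ Ybox t, φ z *
          ∑ a : Fin k, ∑ a' : Fin k, (if a = a' then 0 else Gm pc (νw k w) m (e a' - e a, uo) (0, z)) := by
      have : ∀ a a' : Fin k, (if a = a' then (0 : ℝ) else (c + ∑ z ∈ Ybox t, Gz a a' z * φ z)) =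
          (if a = a' then (0 : ℝ) else c) + ∑ z ∈ Ybox t, φ z * (if a = a' then 0 else Gz a a' z) := by
        intro a a'
        split_ifs
        · simp
        · rw [add_left_cancel_iff.2 (sum_congr rfl fun z _ => mul_comm _ _)]
      simp_rw [this, sum_add_distrib]
      congr 1
      · -- `Σ_{a,a'} [a ≠ a'] c = (k² - k) c`
        have hc' : ∀ a a' : Fin k, (if a = a' then (0 : ℝ) else c) = c - (if a = a' then c else 0) := by
          intro a a'; split_ifs <;> ring
        simp_rw [hc', sum_sub_distrib, sum_ite_eq, if_pos (mem_univ _), sum_const, card_univ, Fintype.card_fin,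
          nsmul_eq_mul]
        ring
      · rw [← Fintype.sum_prod_type', sum_comm]
        refine sum_congr rfl fun z _ => ?_
        rw [← Fintype.sum_prod_type', ← mul_sum]
    -- bound the adjacent Green sums
    have e3 : ∀ z : Fin t → ℤ, ∑ a : Fin k, ∑ a' : Fin k,
        (if a = a' then 0 else Gm pc (νw k w) m (e a' - e a, uo) (0, z)) ≤
          (k : ℝ) * ((k : ℝ) - 1) * (G1N k s N (z - uo) + T) := by
      intro z
      rw [sum_Gm_adj_eq hc hm hk0]
      have hk1 : (0 : ℝ) < (k : ℝ) * ((k : ℝ) - 1) := by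
        have : (2 : ℝ) ≤ k := by exact_mod_cast hk
        nlinarith
      have hre : ∑ i ∈ range m, ((k : ℝ) ^ 2 * u k (i + 1) - k * u k i) * ∏ l, F s (2 * i) (z l - uo l) =
          (k : ℝ) * ((k : ℝ) - 1) * ∑ i ∈ range m, cadj k i * ∏ l, F s (2 * i) ((z - uo) l) := by
        rw [mul_sum]
        refine sum_congr rfl fun i _ => ?_
        have hk1' : (k : ℝ) - 1 ≠ 0 := by
          have : (2 : ℝ) ≤ k := by exact_mod_cast hk
          intro h; linarith
        have hkk : (k : ℝ) ≠ 0 := ne_of_gt hkR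
        have hp : ∏ l, F s (2 * i) ((z - uo) l) = ∏ l, F s (2 * i) (z l - uo l) := rfl
        rw [hp, cadj]
        field_simp
      rw [hre]
      exact mul_le_mul_of_nonneg_left (hT.2 m (z - uo)).2 hk1.le
    have hk1 : (0 : ℝ) ≤ (k : ℝ) * ((k : ℝ) - 1) := by
      have : (2 : ℝ) ≤ k := by exact_mod_cast hk
      nlinarith
    have e4 : ((k : ℝ) ^ 2 - k) * c + ∑ z ∈ Ybox t, φ z *
        ∑ a : Fin k, ∑ a' : Fin k, (if a = a' then 0 else Gm pc (νw k w) m (e a' - e a, uo) (0, z)) ≤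
        (k : ℝ) * ((k : ℝ) - 1) * V1f uo := by
      refine le_trans ?_ (mul_le_mul_of_nonneg_left (hV1 uo hu4) hk1)
      unfold V1
      rw [mul_add, mul_sum]
      refine add_le_add (by nlinarith) (sum_le_sum fun z _ => ?_)
      calc φ z * ∑ a : Fin k, ∑ a' : Fin k, (if a = a' then 0 else Gm pc (νw k w) m (e a' - e a, uo) (0, z))
          ≤ φ z * ((k : ℝ) * ((k : ℝ) - 1) * (G1N k s N (z - uo) + T)) :=
            mul_le_mul_of_nonneg_left (e3 z) (hφ z)
        _ = (k : ℝ) * ((k : ℝ) - 1) * ((G1N k s N (z - uo) + T) * φ z) := by ring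
    rw [e1, e2]
    calc K * (x ^ Sv - 1) * (((k : ℝ) ^ 2 - k) * c + ∑ z ∈ Ybox t, φ z *
          ∑ a : Fin k, ∑ a' : Fin k, (if a = a' then 0 else Gm pc (νw k w) m (e a' - e a, uo) (0, z)))
        ≤ K * (x ^ Sv - 1) * ((k : ℝ) * ((k : ℝ) - 1) * V1f uo) :=
          mul_le_mul_of_nonneg_left e4 (mul_nonneg hK0 hxS)
      _ = w σ * w σ' * (((k : ℝ) - 1) / k * (x ^ Sv - 1) * V1f uo) := by rw [hK]; field_simp
  calc (k : ℝ) * Dval + ∑ a : Fin k, ∑ a' : Fin k, (if a = a' then 0 else Oterm a a')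
      ≤ w σ * w σ' * ((1 / (k : ℝ)) * (x ^ (Sv + ev) - 1) * V0f uo) +
        w σ * w σ' * (((k : ℝ) - 1) / k * (x ^ Sv - 1) * V1f uo) := add_le_add hdiag hoff
    _ = _ := by ring

/-! ### The certificate theorem -/

/-- `A ≥ 1` for probability weights and `x ≥ 1`. -/
theorem one_le_A (R : Off t k → Blk np k → Blk np k → ℕ) (pc : Fin np → List (Fin t × Bool)) {ν : Blk np k → ℝ}
    (hν : ∀ b, 0 ≤ ν b) (hν1 : ∑ b : Blk np k, ν b = 1) {x : ℝ} (hx : 1 ≤ x) (n : ℕ) (o : Off t k) :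
    1 ≤ A R pc ν x n o := by
  have hw : ∀ β : Fin n → Blk np k, 0 ≤ wt' ν β := fun β => prod_nonneg fun j _ => hν _
  calc (1 : ℝ) = (∑ β : Fin n → Blk np k, wt' ν β) * ∑ β' : Fin n → Blk np k, wt' ν β' := by
        rw [sum_wt', hν1, one_pow, one_mul]
    _ = ∑ β : Fin n → Blk np k, ∑ β' : Fin n → Blk np k, wt' ν β * wt' ν β' * 1 := by
        rw [sum_mul_sum]; simp
    _ ≤ A R pc ν x n o := sum_le_sum fun β _ => sum_le_sum fun β' _ =>
        mul_le_mul_of_nonneg_left (one_le_pow₀ hx) (mul_nonneg (hw β) (hw β'))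

/-- **The certificate theorem of PHASE 5**: a passed certificate gives `p_c^bond(ℤ^{k+t}) ≤ p`. -/
theorem criticalProb_le_of_cert (hk : 2 ≤ k) {pc : Fin np → List (Fin t × Bool)} {w : Fin np → ℝ}
    {s : ℝ} (hcube : Cube pc) (hkc : KeyCube pc k) (hm : Marg pc w s) (hw : ∀ σ, 0 ≤ w σ)
    {p : ℝ} (hp0 : 0 < p) (hp1 : p ≤ 1) {N : ℕ} {T : ℝ} (hT : TailBound t k s N T) {c : ℝ} (hc : 0 < c)
    (φ : (Fin t → ℤ) → ℝ) (hφ : ∀ y, 0 ≤ φ y) {V0f V1f : (Fin t → ℤ) → ℝ}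
    (hV0 : ∀ u ∈ Box t 4, V0 k s N T c φ u ≤ V0f u) (hV1 : ∀ u ∈ Box t 4, V1 k s N T c φ u ≤ V1f u)
    (hcert : ∀ y ∈ Ybox t, certLHS pc w k (1 / p) V0f V1f y ≤ φ y) :
    criticalProb (zdGraph (k + t)) (0 : Site (k + t)) ≤ p := by
  have hk0 : 0 < k := by omega
  have hx : 1 ≤ 1 / p := by rw [le_div_iff₀ hp0]; linarith
  have hν0 : ∀ b : Blk np k, 0 ≤ νw k w b := fun b => div_nonneg (hw b.1) (Nat.cast_nonneg k)
  have hν1 : ∑ b : Blk np k, νw k w b = 1 := sum_νw hk0 (sum_w_of_marg hm)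
  set B : Finset (Off t k) := (Ybox t).image (fun y => ((0 : Fin k → ℤ), y)) with hB
  have hsumB : ∀ f : Off t k → ℝ, ∑ z ∈ B, f z = ∑ y ∈ Ybox t, f ((0 : Fin k → ℤ), y) := by
    intro f
    rw [hB, sum_image]
    intro y _ y' _ h
    exact (Prod.mk.inj h).2
  -- the certificate condition of `A_le_of_cert'`
  have hcert' : ∀ m, ∀ o ∈ B, ∑ b : Blk np k, ∑ b' : Blk np k,
      νw k w b * νw k w b' * ((1 / p) ^ Rloc pc o b b' - 1) *
        (c + ∑ z ∈ B, Gm pc (νw k w) m (o + δ pc b b') z * φ z.2) ≤ φ o.2 := by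
    intro m o ho
    obtain ⟨y, hy, rfl⟩ := mem_image.1 ho
    simp_rw [hsumB]
    simp only [Fintype.sum_prod_type]
    calc ∑ σ : Fin np, ∑ a : Fin k, ∑ σ' : Fin np, ∑ a' : Fin k, νw k w (σ, a) * νw k w (σ', a') *
          ((1 / p) ^ Rloc pc ((0 : Fin k → ℤ), y) (σ, a) (σ', a') - 1) *
            (c + ∑ z ∈ Ybox t, Gm pc (νw k w) m ((((0 : Fin k → ℤ), y) : Off t k) + δ pc (σ, a) (σ', a'))
              ((0 : Fin k → ℤ), z) * φ z)
        = ∑ σ : Fin np, ∑ σ' : Fin np, ∑ a : Fin k, ∑ a' : Fin k, νw k w (σ, a) * νw k w (σ', a') *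
          ((1 / p) ^ Rloc pc ((0 : Fin k → ℤ), y) (σ, a) (σ', a') - 1) *
            (c + ∑ z ∈ Ybox t, Gm pc (νw k w) m ((((0 : Fin k → ℤ), y) : Off t k) + δ pc (σ, a) (σ', a'))
              ((0 : Fin k → ℤ), z) * φ z) := sum_congr rfl fun σ _ => sum_comm
      _ ≤ certLHS pc w k (1 / p) V0f V1f y :=
          sum_le_sum fun σ _ => sum_le_sum fun σ' _ =>
            pair_sum_le hk hcube hm hw hx hT c φ hφ hV0 hV1 m hy σ σ'
      _ ≤ φ y := hcert y hy
  -- `A ≤ V₀(0)/c`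
  have hV0ge : ∀ n, c + ∑ z ∈ B, Gm pc (νw k w) n 0 z * φ z.2 ≤ V0 k s N T c φ 0 := by
    intro n
    rw [hsumB]
    unfold V0
    refine add_le_add le_rfl (sum_le_sum fun z _ => mul_le_mul_of_nonneg_right ?_ (hφ z))
    have h0 : (0 : Off t k) = ((0 : Fin k → ℤ), (0 : Fin t → ℤ)) := rfl
    rw [h0, Gm_zero_eq hcube hm hk0]
    exact (hT.2 n (z - 0)).1
  have hA : ∀ n, A (Rloc pc) pc (νw k w) (1 / p) n 0 ≤ V0 k s N T c φ 0 / c := fun n =>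
    (A_le_of_cert' (Rloc pc) pc hν0 hν1 hx B (fun o b b' h => mem_box_of_Rloc_ne_zero hcube hkc h)
      (φ := fun o => φ o.2) (fun z _ => hφ z.2) hc hcert' n).trans (div_le_div_of_nonneg_right (hV0ge n) hc.le)
  have hV0 : 0 < V0 k s N T c φ 0 := by
    have := hV0ge 0
    have h2 : 0 ≤ ∑ z ∈ B, Gm pc (νw k w) 0 0 z * φ z.2 :=
      sum_nonneg fun z _ => mul_nonneg (sum_nonneg fun i _ => Pn_nonneg pc hν0 i _ _) (hφ z.2)
    linarith
  -- `θ(p) ≥ c / V₀(0) > 0`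
  set pI : unitInterval := ⟨p, hp0.le, hp1⟩
  have hθ : c / V0 k s N T c φ 0 ≤ theta (zdGraph (k + t)) (0 : Site (k + t)) pI := by
    refine DCTQ.le_theta_of_forall_le_real_armEvent pI 0 fun m => ?_
    refine le_trans ?_ (le_real_armEvent pc hν0 hν1 pI hp0 m)
    have hApos : 0 < A (Rloc pc) pc (νw k w) (1 / p) (m + 1) 0 :=
      lt_of_lt_of_le one_pos (one_le_A (Rloc pc) pc hν0 hν1 hx (m + 1) 0)
    calc c / V0 k s N T c φ 0 = 1 / (V0 k s N T c φ 0 / c) := by rw [one_div_div]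
      _ ≤ 1 / A (Rloc pc) pc (νw k w) (1 / p) (m + 1) 0 := one_div_le_one_div_of_le hApos (hA (m + 1))
  have hθpos : 0 < theta (zdGraph (k + t)) (0 : Site (k + t)) pI := lt_of_lt_of_le (div_pos hc hV0) hθ
  exact OrbitQuotient.criticalProb_le_of_theta_pos (zdGraph (k + t)) 0 pI hθpos

end Summit.CriticalPhenomena.PercolationContinuityZ3.Theorems.Pcint.BSM

end
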